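import Summits.QuantumFields.BalabanUV.T4Continuum.Support.NE3CovLiftCurl
import Summits.QuantumFields.BalabanUV.T4Continuum.Support.NE3FrameGenLocal
import Summits.QuantumFields.BalabanUV.T4Continuum.Support.NE3PureGaugeFirstVariation
import Summits.QuantumFields.BalabanUV.T4Continuum.Support.NE3SlicePoincareGradientBudget
import Summits.QuantumFields.BalabanUV.T4Continuum.Support.MinimalActionLevels
import Summits.QuantumFields.BalabanUV.T4Continuum.Support.NE3CovariantCompetitorValue
import HarnessLib

/-!
# T⁴ programme, node NE3 — route Π, row Π-R (curved step), file Π-R-W6c: THE CURL LETTERS (R2), (R3), (R6′) OF THE UNSOLVED OPERATOR `hatInvW` —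
# `curlSq`, the window ℓ¹-curl and the window sup-curl of `hatInvW L k W Φ` against `dirSq Φ`, `dirL1 Φ`, `sup‖Φ‖` with weights `M^{d−4}`, `M^{d−2}`, `M^{−2}`

NE3 (node U1b) formalisation swarm, leaf seat `b2b-balaban-t4-ne3-formalise-leaf-01` (gen 8); row Π-R-W, letters (R2)(R3)(R6′) of ruling ρ-g25-1 (2), for
the UNSOLVED operator on a generic periodic coarse field (the compositions with W6b⁰'s solve letters are the assembly `NE3RightInverseLetters`).  PIECES:
W6c¹'s pointwise covariant curl of the lift `norm_curl_covLift_le` (`liftC(1∕M² + 16(d+1)x)`, local in one block); the corrector's curl is the plaquette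
commutator `NE3CurlOfGaugeDir.norm_curlAt_gaugeDir_le` (`≤ 2x·‖ζ‖`) with the covariant tent `ζ = tinterpW M W (−G)` bounded by its vertex data
(`norm_interp_le`, `normSq_interp_le`; unitary transports) and the frame generator `G` by W6a∕W6b¹; the regime letter `(L^{k+1})²·x ≤ 1` turns every
`x` into `1∕M²`; block-by-block summation (`sum_periodBox_blocks`) and Π-R♭-4b's plane count `sum_plane_pair_le`.

CONTENT ([folklore]; 0 sorry; DATA defs `supCurlC`, `curl2C`, `curl1C` — explicit): §1 the covariant tent's size; §2 the pointwise curl of `hatInvW` and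
(R6′); §3 (R2); §4 (R3).

HONEST FRAMING.  Kinematics of OUR objects; constants explicit and crude; nothing about minimisers; (P♮)_W, T-E_w and **NE3 are NOT proved**; spine
PROVED 0∕9; finite T⁴ rung (B)+1 — NOT infinite volume, NOT mass gap, NOT `BetaPertH`, NOT Clay.  PLACEMENT: `Summits/QuantumFields/BalabanUV/`.
HONEST DEPENDENCY (cell page 1): continuum YM on T⁴ ⇐ BetaPertH ∧ nine spine estimates (0/9 proved); BetaPertH ⇐ (D1) ∧ (D4) ∧ CAP+tail;
G-an2-4 gates asym, D1 and NE2/3/4.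
-/

set_option autoImplicit false

open scoped BigOperators Matrix.Norms.L2Operator
open Finset

namespace Summit.QuantumFields.BalabanUV.T4Continuum.NE3HatInvCurlLetters

open Literature.MathematicalPhysics.QuantumFieldTheory.Balaban1983to89
open B7Prop1Explicit B7Prop2Explicit
open T4AveragingDeficitWall (IsUnitaryCfg IsSkewDir SmallField Ad curlAt curl curlSq dirSq dirL1)
open T4AveragingDeficitWallBoundary (IsPeriodicCfg periodBox card_periodBox sum_periodBox_shift)
open AveragingDeficitPeriodicCounting (IsPeriodicDir)
open AveragingDeficitTransport (norm_Ad_of_unitary)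
open AveragingDeficitMultiLevelPrep (cavgIter LevelSmall tower)
open AveragingDeficitBlockDensity (btree btree_mem)
open BlockAveragePushDirGauge (gaugeDir)
open SmoothRefineBlocks (blk)
open SmoothRefineInterp (indic interp norm_interp_le)
open NE3CoarseInterpolant (blk_block)
open NE3BlockLineAverage (sum_periodBox_blocks)
open NE3SpreadLiftCurl (sum_plane_pair_le)
open NE3CovariantTentInterpolant (vtxW tinterpW)
open NE3SlicePoincareGradientBudget (card_plane_le)
open NE3CovariantCompetitorValue (normSq_tinterpW_le)
open NE3CurlOfGaugeDir (norm_curlAt_gaugeDir_le curlSq_gaugeDir_le)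
open NE3PureGaugeFirstVariation (curl_add)
open MinimalActionLevels (perWin)
open NE3CovariantLift (covLift hatInvW frameGen frameGen_add_period)
open NE3QbarIterCovLiftPrep (liftC liftC_nonneg)
open NE3RightInverseSupLetters (frameC norm_framePotW_le_of_sup)
open NE3RightInverseSolveLetters (l1Ball card_l1Ball_le)
open NE3FrameGenLocal (frameRad sum_normSq_frameGen_le sum_norm_frameGen_le)
open NE3CovLiftCurl (norm_curl_covLift_le)

noncomputable section

variable {d : ℕ} {n : Type*} [Fintype n] [DecidableEq n]

/-! ## §1 The covariant tent interpolant is bounded by its vertex data -/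

/-- The transported vertex data have the size of the data. [folklore] -/
theorem norm_vtxW {M : ℕ} {W : Site d → Fin d → (Matrix n n ℂ)ˣ} (hW : IsUnitaryCfg W) (m : Site d → Matrix n n ℂ) (y w : Site d) :
    ‖vtxW M W m y w‖ = ‖m w‖ := by
  unfold vtxW; exact norm_Ad_of_unitary ((unitaryUnits _).inv_mem (btree_mem hW M w y)) _

/-- SUP: `‖tinterpW M W m y‖ ≤ g` if `‖m‖_∞ ≤ g`. [folklore] -/
theorem norm_tinterpW_le_of_sup {M : ℕ} (hM : 1 ≤ M) {W : Site d → Fin d → (Matrix n n ℂ)ˣ} (hW : IsUnitaryCfg W) (m : Site d → Matrix n n ℂ)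
    {g : ℝ} (hm : ∀ w, ‖m w‖ ≤ g) (y : Site d) : ‖tinterpW M W m y‖ ≤ g := by
  unfold tinterpW
  exact norm_interp_le hM _ _ (fun w => by rw [norm_vtxW hW]; exact hm w) y

/-- ℓ¹-LOCAL: `‖tinterpW M W m y‖ ≤ Σ_{T ⊆ univ} ‖m (blk M y + 1_T)‖`. [folklore] -/
theorem norm_tinterpW_le_sum {M : ℕ} (hM : 1 ≤ M) {W : Site d → Fin d → (Matrix n n ℂ)ˣ} (hW : IsUnitaryCfg W) (m : Site d → Matrix n n ℂ)
    (y : Site d) : ‖tinterpW M W m y‖ ≤ ∑ T ∈ (Finset.univ : Finset (Fin d)).powerset, ‖m (blk M y + indic T)‖ := by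
  have h := (normSq_tinterpW_le hM hW m y).trans (Finset.sum_sq_le_sq_sum_of_nonneg fun T _ => norm_nonneg (m (blk M y + indic T)))
  exact (pow_le_pow_iff_left₀ (norm_nonneg _) (Finset.sum_nonneg fun _ _ => norm_nonneg _) two_ne_zero).mp h

/-! ## §2 The pointwise curl of `hatInvW` and the window sup-curl letter (R6′) -/

/-- `hatInvW = covLift + gaugeDir W ζ` as fields. [folklore] -/
theorem hatInvW_eq_add (L k : ℕ) (W : Site d → Fin d → (Matrix n n ℂ)ˣ) (Φ : Site d → Fin d → Matrix n n ℂ) :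
    hatInvW L k W Φ = covLift (L ^ (k + 1)) W Φ + gaugeDir W (tinterpW (L ^ (k + 1)) W fun z => -frameGen L k W Φ z) := by
  funext x μ; rfl

/-- **THE POINTWISE CURL OF `hatInvW`** (unitary `W` with `SmallField W x`, `M = L^{k+1} ≥ 2`): with `ζ = tinterpW M W (−G)`,
`‖curl W (hatInvW L k W Φ) p‖ ≤ liftC·(1∕M² + 16(d+1)x)·(‖Φ(blk p₁, π₁)‖ + ‖Φ(blk p₁, π₂)‖) + 2x·‖ζ p₁‖`. [folklore] -/
theorem norm_curl_hatInvW_le [Nonempty n] {L : ℕ} (hL : 2 ≤ L) (k : ℕ) {W : Site d → Fin d → (Matrix n n ℂ)ˣ} (hWu : IsUnitaryCfg W)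
    {x : ℝ} (hx : 0 ≤ x) (hWx : SmallField W x) (Φ : Site d → Fin d → Matrix n n ℂ) (p : T4AveragingDeficitWall.Plaq d) :
    ‖curl W (hatInvW L k W Φ) p‖
      ≤ liftC d * (1 / ((L : ℝ) ^ (k + 1)) ^ 2 + 16 * ((d : ℝ) + 1) * x) * (‖Φ (blk (L ^ (k + 1)) p.1) p.2.1.1‖ + ‖Φ (blk (L ^ (k + 1)) p.1) p.2.1.2‖)
        + 2 * x * ‖tinterpW (L ^ (k + 1)) W (fun z => -frameGen L k W Φ z) p.1‖ := by
  have hM2 : 2 ≤ L ^ (k + 1) := hL.trans (Nat.le_self_pow (by omega) L)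
  have hMr : (((L ^ (k + 1) : ℕ)) : ℝ) = (L : ℝ) ^ (k + 1) := by push_cast; ring
  rw [hatInvW_eq_add, curl_add]
  refine (norm_add_le _ _).trans (add_le_add ?_ ?_)
  · have h := norm_curl_covLift_le hM2 hWu hx hWx Φ p; rw [hMr] at h; exact h
  · exact norm_curlAt_gaugeDir_le hWu hWx _ p.1 (ne_of_lt p.2.2)

/-- THE SUP-CURL CONSTANT: `supCurlC = 2·liftC·(17 + 16d) + 2·frameC·liftC`. [folklore] -/
def supCurlC (d L : ℕ) : ℝ := 2 * liftC d * (17 + 16 * d) + 2 * frameC d L * liftC d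

/-- **(R6′) FOR `hatInvW`** (`L ≥ 2`, class, regime `(L^{k+1})²x ≤ 1`, `‖Φ‖_∞ ≤ S`): `‖curl W (hatInvW L k W Φ) p‖ ≤ supCurlC ∕ (L^{k+1})² · S` on every
plaquette. [folklore] -/
theorem norm_curl_hatInvW_le_of_sup [Nonempty n] {L : ℕ} (hL : 2 ≤ L) (k : ℕ) {W : Site d → Fin d → (Matrix n n ℂ)ˣ} {x : ℝ}
    (hWu : IsUnitaryCfg W) (hx : 0 ≤ x) (hs : LevelSmall d L k x) (hWx : SmallField W x) (hε : ((L : ℝ) ^ (k + 1)) ^ 2 * x ≤ 1)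
    (Φ : Site d → Fin d → Matrix n n ℂ) {S : ℝ} (hS0 : 0 ≤ S) (hΦ : ∀ (z : Site d) (κ : Fin d), ‖Φ z κ‖ ≤ S) (p : T4AveragingDeficitWall.Plaq d) :
    ‖curl W (hatInvW L k W Φ) p‖ ≤ supCurlC d L / ((L : ℝ) ^ (k + 1)) ^ 2 * S := by
  have hL1 : 1 ≤ L := by omega
  have hpt := norm_curl_hatInvW_le hL k hWu hx hWx Φ p
  set M : ℕ := L ^ (k + 1) with hM
  have hM2 : 2 ≤ M := by rw [hM]; exact hL.trans (Nat.le_self_pow (by omega) L)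
  have hM1 : 1 ≤ M := by omega
  have hMr : ((M : ℕ) : ℝ) = (L : ℝ) ^ (k + 1) := by rw [hM]; push_cast; ring
  have hM0 : (0 : ℝ) < (M : ℝ) := by exact_mod_cast (show 0 < M by omega)
  have hMsq : (0 : ℝ) < (M : ℝ) ^ 2 := by positivity
  have hxM : x ≤ 1 / (M : ℝ) ^ 2 := by rw [le_div_iff₀ hMsq, hMr]; linarith
  rw [← hMr] at hpt
  -- the lift, the frames, the tent
  have hY : ∀ (y' : Site d) (μ' : Fin d), ‖covLift M W Φ y' μ'‖ ≤ liftC d / M * S := fun y' μ' => by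
    rw [NE3CovariantLift.norm_covLift_eq hWu]
    have hd : 1 ≤ d := μ'.pos
    refine (NE3SmoothLiftBounds.norm_smoothLift_le hM2 hd Φ y' μ').trans ?_
    rw [liftC]; exact mul_le_mul_of_nonneg_left (hΦ _ _) (by positivity)
  have hlift0 : 0 ≤ liftC d / M * S := by have := liftC_nonneg d; positivity
  have hG : ∀ w, ‖(fun z => -frameGen L k W Φ z) w‖ ≤ frameC d L * liftC d * S := fun w => by
    simp only [norm_neg, frameGen]
    refine (norm_framePotW_le_of_sup hL k hWu hx hs hWx (covLift M W Φ) hlift0 hY w).trans (le_of_eq ?_)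
    rw [← hMr]; field_simp
  have hζ := norm_tinterpW_le_of_sup hM1 hWu (fun z => -frameGen L k W Φ z) hG p.1
  have hab : ‖Φ (blk M p.1) p.2.1.1‖ + ‖Φ (blk M p.1) p.2.1.2‖ ≤ 2 * S := by linarith [hΦ (blk M p.1) p.2.1.1, hΦ (blk M p.1) p.2.1.2]
  have hl0 := liftC_nonneg d
  have hf0 : 0 ≤ frameC d L := by unfold frameC; positivity
  have hc1 : 0 ≤ liftC d * (1 / (M : ℝ) ^ 2 + 16 * ((d : ℝ) + 1) * x) := by positivity
  rw [← hMr]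
  calc ‖curl W (hatInvW L k W Φ) p‖
      ≤ liftC d * (1 / (M : ℝ) ^ 2 + 16 * ((d : ℝ) + 1) * x) * (2 * S) + 2 * x * (frameC d L * liftC d * S) :=
        hpt.trans (add_le_add (mul_le_mul_of_nonneg_left hab hc1) (mul_le_mul_of_nonneg_left hζ (by positivity)))
    _ ≤ liftC d * (1 / (M : ℝ) ^ 2 + 16 * ((d : ℝ) + 1) * (1 / (M : ℝ) ^ 2)) * (2 * S) + 2 * (1 / (M : ℝ) ^ 2) * (frameC d L * liftC d * S) := by
        have e1 : 16 * ((d : ℝ) + 1) * x ≤ 16 * ((d : ℝ) + 1) * (1 / (M : ℝ) ^ 2) := mul_le_mul_of_nonneg_left hxM (by positivity)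
        have e2 : 2 * x * (frameC d L * liftC d * S) ≤ 2 * (1 / (M : ℝ) ^ 2) * (frameC d L * liftC d * S) :=
          mul_le_mul_of_nonneg_right (by linarith) (by positivity)
        nlinarith [mul_le_mul_of_nonneg_right (mul_le_mul_of_nonneg_left e1 hl0) (show 0 ≤ 2 * S by positivity)]
    _ = supCurlC d L / (M : ℝ) ^ 2 * S := by rw [supCurlC]; field_simp; ring

/-! ## §3 The `curlSq` letter (R2) -/

/-- THE `curlSq` CONSTANT: `curl2C = 8d·liftC²·(17+16d)² + 8d²·2^d·(frameC·liftC)²·(2·frameRad+1)^d`. [folklore] -/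
def curl2C (d L : ℕ) : ℝ :=
  8 * d * liftC d ^ 2 * (17 + 16 * (d : ℝ)) ^ 2 + 8 * (d : ℝ) ^ 2 * (2 : ℝ) ^ d * (frameC d L * liftC d) ^ 2 * (2 * (frameRad d L : ℝ) + 1) ^ d

/-- `0 ≤ curl2C`. [folklore] -/
theorem curl2C_nonneg (d L : ℕ) : 0 ≤ curl2C d L := by unfold curl2C frameC; have := liftC_nonneg d; positivity

/-- `curlSq (Y + Z) ≤ 2·curlSq Y + 2·curlSq Z`. [folklore] -/
theorem curlSq_add_le (V : Site d → Fin d → (Matrix n n ℂ)ˣ) (Y Z : Site d → Fin d → Matrix n n ℂ) (F : Finset (Site d)) :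
    curlSq V (Y + Z) F ≤ 2 * curlSq V Y F + 2 * curlSq V Z F := by
  unfold curlSq
  rw [Finset.mul_sum, Finset.mul_sum, ← Finset.sum_add_distrib]
  refine Finset.sum_le_sum fun z _ => ?_
  rw [Finset.mul_sum, Finset.mul_sum, ← Finset.sum_add_distrib]
  refine Finset.sum_le_sum fun π _ => ?_
  rw [curl_add]
  have h := pow_le_pow_left₀ (norm_nonneg _) (norm_add_le (curl V Y (z, π)) (curl V Z (z, π))) 2
  nlinarith [sq_nonneg (‖curl V Y (z, π)‖ - ‖curl V Z (z, π)‖)]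

/-- **(R2) FOR `hatInvW`** (`L ≥ 2`, class, `W` of period `L^{k+1}·N`, regime `(L^{k+1})²x ≤ 1`, `Φ` `N`-periodic):
`curlSq W (hatInvW L k W Φ) (periodBox (N·L^{k+1})) ≤ curl2C·((L^{k+1})^d ∕ (L^{k+1})⁴)·dirSq Φ (periodBox N)`. [folklore] -/
theorem curlSq_hatInvW_le [Nonempty n] {L : ℕ} (hL : 2 ≤ L) (k : ℕ) {N : ℕ} [NeZero N] {W : Site d → Fin d → (Matrix n n ℂ)ˣ} {x : ℝ}
    (hWu : IsUnitaryCfg W) (hWP : IsPeriodicCfg W ((tower L N (k + 1) : ℕ) : ℤ)) (hx : 0 ≤ x) (hs : LevelSmall d L k x) (hWx : SmallField W x)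
    (hε : ((L : ℝ) ^ (k + 1)) ^ 2 * x ≤ 1) {Φ : Site d → Fin d → Matrix n n ℂ} (hΦP : IsPeriodicDir Φ (N : ℤ)) :
    curlSq W (hatInvW L k W Φ) (periodBox (d := d) (N * L ^ (k + 1)))
      ≤ curl2C d L * (((L : ℝ) ^ (k + 1)) ^ d / ((L : ℝ) ^ (k + 1)) ^ 4) * dirSq Φ (periodBox (d := d) N) := by
  have hL1 : 1 ≤ L := by omega
  have hN1 : 1 ≤ N := Nat.one_le_iff_ne_zero.mpr (NeZero.ne N)
  obtain ⟨M, hM⟩ : ∃ M : ℕ, M = L ^ (k + 1) := ⟨_, rfl⟩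
  have hM2 : 2 ≤ M := by rw [hM]; exact hL.trans (Nat.le_self_pow (by omega) L)
  have hM1 : 1 ≤ M := by omega
  have hMr : ((M : ℕ) : ℝ) = (L : ℝ) ^ (k + 1) := by rw [hM]; push_cast; ring
  have hM0 : (0 : ℝ) < (M : ℝ) := by exact_mod_cast (show 0 < M by omega)
  have hMsq : (0 : ℝ) < (M : ℝ) ^ 2 := by positivity
  have hxM : x ≤ 1 / (M : ℝ) ^ 2 := by rw [le_div_iff₀ hMsq, hMr]; linarith
  have hεM : (M : ℝ) ^ 2 * x ≤ 1 := by rw [hMr]; exact hε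
  rw [← hMr, Nat.mul_comm N, ← hM, hatInvW_eq_add, ← hM]
  set G : Site d → Matrix n n ℂ := fun z => -frameGen L k W Φ z with hGdef
  set ζ : Site d → Matrix n n ℂ := tinterpW M W G with hζ
  set D : ℝ := dirSq Φ (periodBox (d := d) N) with hD
  have hD0 : 0 ≤ D := by rw [hD]; unfold dirSq; positivity
  have hl0 := liftC_nonneg d
  have hf0 : 0 ≤ frameC d L := by unfold frameC; positivity
  -- (i) the lift: pointwise, over planes, block by block
  set C : ℝ := liftC d * (1 / (M : ℝ) ^ 2 + 16 * ((d : ℝ) + 1) * x) with hC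
  have hC0 : 0 ≤ C := by positivity
  have hCle : C ≤ liftC d * (17 + 16 * (d : ℝ)) / (M : ℝ) ^ 2 := by
    rw [hC, le_div_iff₀ hMsq]
    have : liftC d * (1 / (M : ℝ) ^ 2 + 16 * ((d : ℝ) + 1) * x) * (M : ℝ) ^ 2 = liftC d * (1 + 16 * ((d : ℝ) + 1) * ((M : ℝ) ^ 2 * x)) := by
      field_simp
    rw [this]
    have h16 : 0 ≤ 16 * ((d : ℝ) + 1) := by positivity
    nlinarith [mul_le_mul_of_nonneg_left hεM h16, mul_nonneg hl0 (mul_nonneg h16 (sub_nonneg.2 hεM))]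
  have hsite : ∀ y : Site d, ∑ π : T4AveragingDeficitWall.Plane d, ‖curl W (covLift M W Φ) (y, π)‖ ^ 2
      ≤ 2 * C ^ 2 * (2 * d * ∑ κ : Fin d, ‖Φ (blk M y) κ‖ ^ 2) := by
    intro y
    have hpl : ∀ π : T4AveragingDeficitWall.Plane d, ‖curl W (covLift M W Φ) (y, π)‖ ^ 2
        ≤ 2 * C ^ 2 * (‖Φ (blk M y) π.1.1‖ ^ 2 + ‖Φ (blk M y) π.1.2‖ ^ 2) := by
      intro π
      have h := norm_curl_covLift_le hM2 hWu hx hWx Φ (y, π)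
      rw [← hC] at h
      calc ‖curl W (covLift M W Φ) (y, π)‖ ^ 2 ≤ (C * (‖Φ (blk M y) π.1.1‖ + ‖Φ (blk M y) π.1.2‖)) ^ 2 :=
            pow_le_pow_left₀ (norm_nonneg _) h 2
        _ ≤ _ := by rw [mul_pow]; nlinarith [sq_nonneg (‖Φ (blk M y) π.1.1‖ - ‖Φ (blk M y) π.1.2‖), sq_nonneg C]
    calc _ ≤ ∑ π : T4AveragingDeficitWall.Plane d, 2 * C ^ 2 * (‖Φ (blk M y) π.1.1‖ ^ 2 + ‖Φ (blk M y) π.1.2‖ ^ 2) :=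
          Finset.sum_le_sum fun π _ => hpl π
      _ = 2 * C ^ 2 * ∑ π : T4AveragingDeficitWall.Plane d, (‖Φ (blk M y) π.1.1‖ ^ 2 + ‖Φ (blk M y) π.1.2‖ ^ 2) := by rw [Finset.mul_sum]
      _ ≤ _ := mul_le_mul_of_nonneg_left (sum_plane_pair_le (h := fun κ => ‖Φ (blk M y) κ‖ ^ 2) fun κ => sq_nonneg _) (by positivity)
  have hlift : curlSq W (covLift M W Φ) (periodBox (d := d) (M * N)) ≤ 4 * d * C ^ 2 * (M : ℝ) ^ d * D := by
    unfold curlSq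
    calc ∑ y ∈ periodBox (d := d) (M * N), ∑ π : T4AveragingDeficitWall.Plane d, ‖curl W (covLift M W Φ) (y, π)‖ ^ 2
        ≤ ∑ y ∈ periodBox (d := d) (M * N), 2 * C ^ 2 * (2 * d * ∑ κ : Fin d, ‖Φ (blk M y) κ‖ ^ 2) := Finset.sum_le_sum fun y _ => hsite y
      _ = (M : ℝ) ^ d * ∑ z ∈ periodBox (d := d) N, 2 * C ^ 2 * (2 * d * ∑ κ : Fin d, ‖Φ z κ‖ ^ 2) := by
          rw [← sum_periodBox_blocks M N hM1, Finset.mul_sum]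
          refine Finset.sum_congr rfl fun z _ => ?_
          rw [Finset.sum_congr rfl fun v hv => by rw [blk_block hM1 z hv], Finset.sum_const, card_periodBox, nsmul_eq_mul, Nat.cast_pow]
      _ = 4 * d * C ^ 2 * (M : ℝ) ^ d * D := by rw [hD]; unfold dirSq; simp only [← Finset.mul_sum]; ring
  -- (ii) the corrector: plaquette commutators against the tent, the tent against the frames
  have hGper : ∀ (z : Site d) (τ : Fin d), G (z + (N : ℤ) • e τ) = G z := by
    intro z τ; simp only [hGdef, frameGen_add_period hL k hWP hΦP z τ]
  have hGsq : ∑ z ∈ periodBox (d := d) N, ‖G z‖ ^ 2 ≤ (frameC d L * liftC d) ^ 2 * (2 * (frameRad d L : ℝ) + 1) ^ d * D := by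
    have h := sum_normSq_frameGen_le hL k hWu hx hs hWx hN1 hΦP
    have hneg : ∑ z ∈ periodBox (d := d) N, ‖G z‖ ^ 2 = ∑ z ∈ periodBox (d := d) N, ‖frameGen L k W Φ z‖ ^ 2 := by simp only [hGdef, norm_neg]
    rw [hneg]
    refine h.trans ?_
    have hcard : (((l1Ball (frameRad d L) : Finset (Site d))).card : ℝ) ≤ (2 * (frameRad d L : ℝ) + 1) ^ d := by
      exact_mod_cast card_l1Ball_le (d := d) (frameRad d L)
    rw [← hD]
    exact mul_le_mul_of_nonneg_right (mul_le_mul_of_nonneg_left hcard (sq_nonneg _)) hD0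
  have hζsq : ∑ y ∈ periodBox (d := d) (M * N), ‖ζ y‖ ^ 2 ≤ (M : ℝ) ^ d * (2 : ℝ) ^ d * ∑ z ∈ periodBox (d := d) N, ‖G z‖ ^ 2 := by
    have hshift : ∀ T : Finset (Fin d), ∑ z ∈ periodBox (d := d) N, ‖G (z + indic T)‖ ^ 2 = ∑ z ∈ periodBox (d := d) N, ‖G z‖ ^ 2 :=
      fun T => sum_periodBox_shift N hN1 (g := fun z => ‖G z‖ ^ 2) (fun w κ => by simp only [hGper]) (indic T)
    have hcardU : (((Finset.univ : Finset (Fin d)).powerset.card : ℝ)) = (2 : ℝ) ^ d := by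
      rw [Finset.card_powerset, Finset.card_univ, Fintype.card_fin]; push_cast; ring
    calc ∑ y ∈ periodBox (d := d) (M * N), ‖ζ y‖ ^ 2
        ≤ ∑ y ∈ periodBox (d := d) (M * N), ∑ T ∈ (Finset.univ : Finset (Fin d)).powerset, ‖G (blk M y + indic T)‖ ^ 2 :=
          Finset.sum_le_sum fun y _ => by rw [hζ]; exact normSq_tinterpW_le hM1 hWu G y
      _ = (M : ℝ) ^ d * ∑ z ∈ periodBox (d := d) N, ∑ T ∈ (Finset.univ : Finset (Fin d)).powerset, ‖G (z + indic T)‖ ^ 2 := by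
          rw [← sum_periodBox_blocks M N hM1, Finset.mul_sum]
          refine Finset.sum_congr rfl fun z _ => ?_
          rw [Finset.sum_congr rfl fun v hv => by rw [blk_block hM1 z hv], Finset.sum_const, card_periodBox, nsmul_eq_mul, Nat.cast_pow]
      _ = (M : ℝ) ^ d * (2 : ℝ) ^ d * ∑ z ∈ periodBox (d := d) N, ‖G z‖ ^ 2 := by
          rw [Finset.sum_comm, Finset.sum_congr rfl fun T _ => hshift T, Finset.sum_const, nsmul_eq_mul, hcardU]; ring
  have hcorr : curlSq W (gaugeDir W ζ) (periodBox (d := d) (M * N)) ≤ 4 * x ^ 2 * (d : ℝ) ^ 2 * ((M : ℝ) ^ d * (2 : ℝ) ^ d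
      * ((frameC d L * liftC d) ^ 2 * (2 * (frameRad d L : ℝ) + 1) ^ d * D)) := by
    refine (curlSq_gaugeDir_le hWu hWx ζ _).trans ?_
    have hz0 : 0 ≤ ∑ y ∈ periodBox (d := d) (M * N), ‖ζ y‖ ^ 2 := Finset.sum_nonneg fun _ _ => sq_nonneg _
    calc 4 * x ^ 2 * (Fintype.card (T4AveragingDeficitWall.Plane d) : ℝ) * ∑ y ∈ periodBox (d := d) (M * N), ‖ζ y‖ ^ 2
        ≤ 4 * x ^ 2 * (d : ℝ) ^ 2 * ∑ y ∈ periodBox (d := d) (M * N), ‖ζ y‖ ^ 2 :=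
          mul_le_mul_of_nonneg_right (mul_le_mul_of_nonneg_left (card_plane_le d) (by positivity)) hz0
      _ ≤ _ := mul_le_mul_of_nonneg_left (hζsq.trans (mul_le_mul_of_nonneg_left hGsq (by positivity))) (by positivity)
  -- (iii) assemble with `x ≤ 1∕M²`
  have hsplit := curlSq_add_le W (covLift M W Φ) (gaugeDir W ζ) (periodBox (d := d) (M * N))
  have hx2 : x ^ 2 ≤ (1 / (M : ℝ) ^ 2) ^ 2 := pow_le_pow_left₀ hx hxM 2
  have hC2 : C ^ 2 ≤ (liftC d * (17 + 16 * (d : ℝ)) / (M : ℝ) ^ 2) ^ 2 := pow_le_pow_left₀ hC0 hCle 2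
  have hMd : 0 ≤ (M : ℝ) ^ d := by positivity
  set K : ℝ := (frameC d L * liftC d) ^ 2 * (2 * (frameRad d L : ℝ) + 1) ^ d with hK
  have hK0 : 0 ≤ K := by positivity
  calc curlSq W (covLift M W Φ + gaugeDir W ζ) (periodBox (d := d) (M * N))
      ≤ 2 * (4 * d * C ^ 2 * (M : ℝ) ^ d * D) + 2 * (4 * x ^ 2 * (d : ℝ) ^ 2 * ((M : ℝ) ^ d * (2 : ℝ) ^ d * (K * D))) := by
        exact hsplit.trans (add_le_add (mul_le_mul_of_nonneg_left hlift (by norm_num)) (mul_le_mul_of_nonneg_left hcorr (by norm_num)))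
    _ ≤ 2 * (4 * d * (liftC d * (17 + 16 * (d : ℝ)) / (M : ℝ) ^ 2) ^ 2 * (M : ℝ) ^ d * D)
        + 2 * (4 * (1 / (M : ℝ) ^ 2) ^ 2 * (d : ℝ) ^ 2 * ((M : ℝ) ^ d * (2 : ℝ) ^ d * (K * D))) := by
        have e1 := mul_le_mul_of_nonneg_right (mul_le_mul_of_nonneg_left hC2 (show (0 : ℝ) ≤ 4 * d by positivity)) (mul_nonneg hMd hD0)
        have e2 := mul_le_mul_of_nonneg_right (mul_le_mul_of_nonneg_left hx2 (show (0 : ℝ) ≤ 4 by norm_num))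
          (show 0 ≤ (d : ℝ) ^ 2 * ((M : ℝ) ^ d * (2 : ℝ) ^ d * (K * D)) by positivity)
        nlinarith [e1, e2]
    _ = curl2C d L * ((M : ℝ) ^ d / (M : ℝ) ^ 4) * D := by rw [curl2C, hK]; field_simp; ring

/-! ## §4 The window ℓ¹-curl letter (R3) -/

/-- THE ℓ¹-CURL CONSTANT: `curl1C = 2d·liftC·(17+16d) + 2d²·2^d·frameC·liftC·(2·frameRad+1)^d`. [folklore] -/
def curl1C (d L : ℕ) : ℝ :=
  2 * d * liftC d * (17 + 16 * (d : ℝ)) + 2 * (d : ℝ) ^ 2 * (2 : ℝ) ^ d * (frameC d L * liftC d) * (2 * (frameRad d L : ℝ) + 1) ^ d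

/-- `0 ≤ curl1C`. [folklore] -/
theorem curl1C_nonneg (d L : ℕ) : 0 ≤ curl1C d L := by unfold curl1C frameC; have := liftC_nonneg d; positivity

/-- **(R3) FOR `hatInvW`** (`L ≥ 2`, class, `W` of period `L^{k+1}·N`, regime `(L^{k+1})²x ≤ 1`, `Φ` `N`-periodic):
`Σ_{p ∈ perWin d (N·L^{k+1})} ‖curl W (hatInvW L k W Φ) p‖ ≤ curl1C·((L^{k+1})^d ∕ (L^{k+1})²)·dirL1 Φ (periodBox N)`. [folklore] -/
theorem sum_norm_curl_hatInvW_le [Nonempty n] {L : ℕ} (hL : 2 ≤ L) (k : ℕ) {N : ℕ} [NeZero N] {W : Site d → Fin d → (Matrix n n ℂ)ˣ} {x : ℝ}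
    (hWu : IsUnitaryCfg W) (hWP : IsPeriodicCfg W ((tower L N (k + 1) : ℕ) : ℤ)) (hx : 0 ≤ x) (hs : LevelSmall d L k x) (hWx : SmallField W x)
    (hε : ((L : ℝ) ^ (k + 1)) ^ 2 * x ≤ 1) {Φ : Site d → Fin d → Matrix n n ℂ} (hΦP : IsPeriodicDir Φ (N : ℤ)) :
    ∑ p ∈ perWin d (N * L ^ (k + 1)), ‖curl W (hatInvW L k W Φ) p‖
      ≤ curl1C d L * (((L : ℝ) ^ (k + 1)) ^ d / ((L : ℝ) ^ (k + 1)) ^ 2) * dirL1 Φ (periodBox (d := d) N) := by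
  have hL1 : 1 ≤ L := by omega
  have hN1 : 1 ≤ N := Nat.one_le_iff_ne_zero.mpr (NeZero.ne N)
  obtain ⟨M, hM⟩ : ∃ M : ℕ, M = L ^ (k + 1) := ⟨_, rfl⟩
  have hM2 : 2 ≤ M := by rw [hM]; exact hL.trans (Nat.le_self_pow (by omega) L)
  have hM1 : 1 ≤ M := by omega
  have hMr : ((M : ℕ) : ℝ) = (L : ℝ) ^ (k + 1) := by rw [hM]; push_cast; ring
  have hM0 : (0 : ℝ) < (M : ℝ) := by exact_mod_cast (show 0 < M by omega)
  have hMsq : (0 : ℝ) < (M : ℝ) ^ 2 := by positivity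
  have hxM : x ≤ 1 / (M : ℝ) ^ 2 := by rw [le_div_iff₀ hMsq, hMr]; linarith
  have hεM : (M : ℝ) ^ 2 * x ≤ 1 := by rw [hMr]; exact hε
  rw [← hMr, Nat.mul_comm N, ← hM]
  unfold perWin
  rw [Finset.sum_product]
  set G : Site d → Matrix n n ℂ := fun z => -frameGen L k W Φ z with hGdef
  set D : ℝ := dirL1 Φ (periodBox (d := d) N) with hD
  have hD0 : 0 ≤ D := by rw [hD]; unfold dirL1; positivity
  have hl0 := liftC_nonneg d
  have hf0 : 0 ≤ frameC d L := by unfold frameC; positivity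
  set C : ℝ := liftC d * (1 / (M : ℝ) ^ 2 + 16 * ((d : ℝ) + 1) * x) with hC
  have hC0 : 0 ≤ C := by positivity
  have hCle : C ≤ liftC d * (17 + 16 * (d : ℝ)) / (M : ℝ) ^ 2 := by
    rw [hC, le_div_iff₀ hMsq]
    have : liftC d * (1 / (M : ℝ) ^ 2 + 16 * ((d : ℝ) + 1) * x) * (M : ℝ) ^ 2 = liftC d * (1 + 16 * ((d : ℝ) + 1) * ((M : ℝ) ^ 2 * x)) := by
      field_simp
    rw [this]
    have h16 : 0 ≤ 16 * ((d : ℝ) + 1) := by positivity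
    nlinarith [mul_le_mul_of_nonneg_left hεM h16, mul_nonneg hl0 (mul_nonneg h16 (sub_nonneg.2 hεM))]
  -- pointwise bound at each plaquette, then the plane count
  have hGper : ∀ (z : Site d) (τ : Fin d), G (z + (N : ℤ) • e τ) = G z := by
    intro z τ; simp only [hGdef, frameGen_add_period hL k hWP hΦP z τ]
  have hpt : ∀ (y : Site d) (π : T4AveragingDeficitWall.Plane d), ‖curl W (hatInvW L k W Φ) (y, π)‖
      ≤ C * (‖Φ (blk M y) π.1.1‖ + ‖Φ (blk M y) π.1.2‖) + 2 * x * ∑ T ∈ (Finset.univ : Finset (Fin d)).powerset, ‖G (blk M y + indic T)‖ := by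
    intro y π
    have h := norm_curl_hatInvW_le hL k hWu hx hWx Φ (y, π)
    rw [← hM, ← hMr, ← hC] at h
    exact h.trans (add_le_add le_rfl (mul_le_mul_of_nonneg_left (norm_tinterpW_le_sum hM1 hWu G y) (by positivity)))
  have hsite : ∀ y : Site d, ∑ π : T4AveragingDeficitWall.Plane d, ‖curl W (hatInvW L k W Φ) (y, π)‖
      ≤ C * (2 * d * ∑ κ : Fin d, ‖Φ (blk M y) κ‖) + (d : ℝ) ^ 2 * (2 * x * ∑ T ∈ (Finset.univ : Finset (Fin d)).powerset, ‖G (blk M y + indic T)‖) := by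
    intro y
    refine (Finset.sum_le_sum fun π _ => hpt y π).trans ?_
    rw [Finset.sum_add_distrib, ← Finset.mul_sum, Finset.sum_const, Finset.card_univ, nsmul_eq_mul]
    refine add_le_add (mul_le_mul_of_nonneg_left (sum_plane_pair_le (h := fun κ => ‖Φ (blk M y) κ‖) fun κ => norm_nonneg _) hC0) ?_
    exact mul_le_mul_of_nonneg_right (card_plane_le d) (by positivity)
  -- block by block and shift invariance
  have hshiftM : ∀ T : Finset (Fin d), ∑ z ∈ periodBox (d := d) N, ‖G (z + indic T)‖ = ∑ z ∈ periodBox (d := d) N, ‖G z‖ :=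
    fun T => sum_periodBox_shift N hN1 (g := fun z => ‖G z‖) (fun w κ => by simp only [hGper]) (indic T)
  have hcardU : (((Finset.univ : Finset (Fin d)).powerset.card : ℝ)) = (2 : ℝ) ^ d := by
    rw [Finset.card_powerset, Finset.card_univ, Fintype.card_fin]; push_cast; ring
  have hG1 : ∑ z ∈ periodBox (d := d) N, ‖G z‖ ≤ frameC d L * liftC d * (2 * (frameRad d L : ℝ) + 1) ^ d * D := by
    have h := sum_norm_frameGen_le hL k hWu hx hs hWx hN1 hΦP
    have hneg : ∑ z ∈ periodBox (d := d) N, ‖G z‖ = ∑ z ∈ periodBox (d := d) N, ‖frameGen L k W Φ z‖ := by simp only [hGdef, norm_neg]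
    rw [hneg, hD]
    refine h.trans ?_
    have hcard : (((l1Ball (frameRad d L) : Finset (Site d))).card : ℝ) ≤ (2 * (frameRad d L : ℝ) + 1) ^ d := by
      exact_mod_cast card_l1Ball_le (d := d) (frameRad d L)
    exact mul_le_mul_of_nonneg_right (mul_le_mul_of_nonneg_left hcard (mul_nonneg hf0 hl0)) (by rw [← hD]; exact hD0)
  calc ∑ y ∈ periodBox (d := d) (M * N), ∑ π : T4AveragingDeficitWall.Plane d, ‖curl W (hatInvW L k W Φ) (y, π)‖
      ≤ ∑ y ∈ periodBox (d := d) (M * N), (C * (2 * d * ∑ κ : Fin d, ‖Φ (blk M y) κ‖)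
          + (d : ℝ) ^ 2 * (2 * x * ∑ T ∈ (Finset.univ : Finset (Fin d)).powerset, ‖G (blk M y + indic T)‖)) := Finset.sum_le_sum fun y _ => hsite y
    _ = (M : ℝ) ^ d * ∑ z ∈ periodBox (d := d) N, (C * (2 * d * ∑ κ : Fin d, ‖Φ z κ‖)
          + (d : ℝ) ^ 2 * (2 * x * ∑ T ∈ (Finset.univ : Finset (Fin d)).powerset, ‖G (z + indic T)‖)) := by
        rw [← sum_periodBox_blocks M N hM1, Finset.mul_sum]
        refine Finset.sum_congr rfl fun z _ => ?_
        rw [Finset.sum_congr rfl fun v hv => by rw [blk_block hM1 z hv], Finset.sum_const, card_periodBox, nsmul_eq_mul, Nat.cast_pow]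
    _ = (M : ℝ) ^ d * (C * (2 * d * D) + (d : ℝ) ^ 2 * (2 * x * ((2 : ℝ) ^ d * ∑ z ∈ periodBox (d := d) N, ‖G z‖))) := by
        have hGsum : ∑ z ∈ periodBox (d := d) N, ∑ T ∈ (Finset.univ : Finset (Fin d)).powerset, ‖G (z + indic T)‖
            = (2 : ℝ) ^ d * ∑ z ∈ periodBox (d := d) N, ‖G z‖ := by
          rw [Finset.sum_comm, Finset.sum_congr rfl fun T _ => hshiftM T, Finset.sum_const, nsmul_eq_mul, hcardU]
        have hΦsum : ∑ z ∈ periodBox (d := d) N, ∑ κ : Fin d, ‖Φ z κ‖ = D := by rw [hD]; rfl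
        simp only [Finset.sum_add_distrib, ← Finset.mul_sum]
        rw [hGsum, hΦsum]
    _ ≤ (M : ℝ) ^ d * ((liftC d * (17 + 16 * (d : ℝ)) / (M : ℝ) ^ 2) * (2 * d * D)
          + (d : ℝ) ^ 2 * (2 * (1 / (M : ℝ) ^ 2) * ((2 : ℝ) ^ d * (frameC d L * liftC d * (2 * (frameRad d L : ℝ) + 1) ^ d * D)))) := by
        have hG0 : 0 ≤ ∑ z ∈ periodBox (d := d) N, ‖G z‖ := Finset.sum_nonneg fun _ _ => norm_nonneg _
        have e1 := mul_le_mul_of_nonneg_right hCle (show 0 ≤ 2 * d * D by positivity)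
        have e2 : 2 * x * ((2 : ℝ) ^ d * ∑ z ∈ periodBox (d := d) N, ‖G z‖)
            ≤ 2 * (1 / (M : ℝ) ^ 2) * ((2 : ℝ) ^ d * (frameC d L * liftC d * (2 * (frameRad d L : ℝ) + 1) ^ d * D)) :=
          mul_le_mul (by linarith) (mul_le_mul_of_nonneg_left hG1 (by positivity)) (by positivity) (by positivity)
        have hMd : 0 ≤ (M : ℝ) ^ d := by positivity
        nlinarith [mul_le_mul_of_nonneg_left (add_le_add e1 (mul_le_mul_of_nonneg_left e2 (sq_nonneg (d : ℝ)))) hMd]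
    _ = curl1C d L * ((M : ℝ) ^ d / (M : ℝ) ^ 2) * D := by rw [curl1C]; field_simp

end

end Summit.QuantumFields.BalabanUV.T4Continuum.NE3HatInvCurlLetters
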